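import Summits.Ventures.CertifiedManyBodySolver.Observables.PhaseSeparationExclusionBoxThermalHotAnchor
import Literature.MathematicalPhysics.QuantumLattice.HubbardTTPrimePhaseCoexistenceExclusionZeeman
import HarnessLib

/-!
# Ventures/CertifiedManyBodySolver — Observables/PhaseSeparationExclusionBoxZeeman.lean

HONEST FRAMING: the FIELD (H-axis) edition of `Observables/PhaseSeparationExclusionBox{,ThermalHotAnchor}.lean` — EXCLUSION of
MACROSCOPIC PHASE COEXISTENCE (a phase of density `≤ n₁` with a phase of density `≥ n₂ ≤ 1`) on a `(t′, U)` CELL of a material box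
IN A UNIFORM ZEEMAN FIELD `h` (coupled to `N↑ − N↓`; no orbital coupling), among FIELD GROUND STATES (`T = 0`) and among CANONICAL
FIELD EQUILIBRIUM STATES (`T > 0`, every `β ≥ β₀`), for every `|h| ≤ h₀` — from the SAME zero-field inputs as the parents (cap affine in
`U`, two `n₂`-column laws, a dilute floor, cell-uniform hot anchors). The only change is the constant `h₀·(a n₁ + b n₂)` subtracted from
every margin (law `Literature/…/HubbardTTPrimePhaseCoexistenceExclusionZeeman.lean`: the field lowers the zero-field floors by at most
`|h|·n_i`). CONTROL class; conditional on the rows and anchors the instances name; nothing about stripes / finite-period states, about which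
phase is realised, about orbital-field physics, or about superconductivity; no number of record. Zero compute, no definition, no claim node,
no `sorry`.

Cell `pub/hubbard-downfold` (MO-S1 ↔ S2 seam «box ↦ one word»; D-0096 (ii)+(iii), D-0098 `T × P × H`), seat `hubbard-downfold-unc-2`
(`prover-hubbard-downfold-unc-2-g21-0`). Contents:
* `hotAnchor_chord_slack` — pure algebra: the cell margin and the anchored slack at `(s, U)` are the `U`-chords of the column ones
  (the constant field cost `k` rides along);
* `psH_not_fieldGroundState_mix_on_cell_of_columns` / `…_above_column` — `T = 0` COLUMN FORMS in the field: positive column margins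
  AFTER subtracting `h₀·(a n₁ + b n₂)` ⇒ no `(≤ n₁ ∣ ≥ n₂)` mixture is a field ground state anywhere on the cell, any `|h| ≤ h₀`;
* `psHT_not_fieldEquilibrium_mix_on_cell_of_columns_hotAnchor` / `…_above_column_hotAnchor` — `T > 0` COLUMN × THRESHOLD FORMS in the
  field: the parents' hypotheses with `c₀ ↦ c₀ + h₀·(a n₁ + b n₂)` ⇒ the exclusion among canonical field equilibrium states at every
  `β ≥ β₀`, `|h| ≤ h₀`, everywhere on the cell.
Instances: `Downfold/BoxesLa214V115M2cPhaseSeparationZeeman.lean` (LSCO `x = 1/8` cells).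
References: R. B. Israel, *Convexity in the Theory of Lattice Gases* (1979) Thm I.2.4 [Israel1979]; R. B. Griffiths, J. Math. Phys. 5
(1964) 1215 [Griffiths1964]; E. H. Lieb, PRL 62 (1989) 1201 [LiebPRL1989]; D. Poulin, M. B. Hastings, PRL 106 (2011) 080403
[PoulinHastings2011]; V. J. Emery, S. A. Kivelson, H. Q. Lin, PRL 64 (1990) 475 [EmeryKivelsonLin1990].
-/

noncomputable section

namespace Summit.Ventures.CertifiedManyBodySolver.Observables

open Literature.MathematicalPhysics.QuantumLattice Literature.MathematicalPhysics.QuantumLattice.ThermodynamicLimit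
open Literature.MathematicalPhysics.QuantumLattice.InfVolFermionState Set Filter

/-- **Column slacks ⇒ cell slack (pure algebra).** With a cap affine in `U` (`c₀ + c₁U`), a constant extra cost `k`, a dilute floor `F`
and the `U`-chord of two column laws `L₁, L₂` as the dense floor: if on both columns the margin `aF + bL_i − (c₀ + c₁U_i) − k` is `≥ 0` and
the anchored inequality `aπ₁ + bπ₂ + β_{h,1}(aF) + β_{h,2}(bL_i) < β₀·(margin_i)` holds, then both hold at every `U ∈ [U₁, U₂]` with the chord
floor (everything is affine in `U`). [folklore] -/
theorem hotAnchor_chord_slack {U₁ U₂ U a b F L₁ L₂ c₀ c₁ k β₀ βh₁ βh₂ π₁ π₂ : ℝ} (h12 : U₁ < U₂) (hU : U ∈ Icc U₁ U₂)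
    (hm₁ : 0 ≤ a * F + b * L₁ - (c₀ + c₁ * U₁) - k) (hm₂ : 0 ≤ a * F + b * L₂ - (c₀ + c₁ * U₂) - k)
    (hg₁ : a * π₁ + b * π₂ + βh₁ * (a * F) + βh₂ * (b * L₁) < β₀ * (a * F + b * L₁ - (c₀ + c₁ * U₁) - k))
    (hg₂ : a * π₁ + b * π₂ + βh₁ * (a * F) + βh₂ * (b * L₂) < β₀ * (a * F + b * L₂ - (c₀ + c₁ * U₂) - k)) :
    0 ≤ a * F + b * (((U₂ - U) * L₁ + (U - U₁) * L₂) / (U₂ - U₁)) - (c₀ + c₁ * U) - k ∧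
      a * π₁ + b * π₂ + βh₁ * (a * F) + βh₂ * (b * (((U₂ - U) * L₁ + (U - U₁) * L₂) / (U₂ - U₁))) <
        β₀ * (a * F + b * (((U₂ - U) * L₁ + (U - U₁) * L₂) / (U₂ - U₁)) - (c₀ + c₁ * U) - k) := by
  have hd : (U₂ - U₁) ≠ 0 := (sub_pos.2 h12).ne'
  constructor
  · have hge := chord_ge_of_ends_ge h12 hU hm₁ hm₂
    have hid : a * F + b * (((U₂ - U) * L₁ + (U - U₁) * L₂) / (U₂ - U₁)) - (c₀ + c₁ * U) - k =
        ((U₂ - U) * (a * F + b * L₁ - (c₀ + c₁ * U₁) - k) + (U - U₁) * (a * F + b * L₂ - (c₀ + c₁ * U₂) - k)) /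
          (U₂ - U₁) := by
      field_simp
      ring
    rw [hid]
    exact hge
  · have e₁ : a * π₁ + b * π₂ < β₀ * (a * F + b * L₁ - (c₀ + c₁ * U₁) - k) - (βh₁ * (a * F) + βh₂ * (b * L₁)) := by
      linarith
    have e₂ : a * π₁ + b * π₂ < β₀ * (a * F + b * L₂ - (c₀ + c₁ * U₂) - k) - (βh₁ * (a * F) + βh₂ * (b * L₂)) := by
      linarith
    have hchord := chord_gt_of_ends_gt h12 hU e₁ e₂
    have hid : β₀ * (a * F + b * (((U₂ - U) * L₁ + (U - U₁) * L₂) / (U₂ - U₁)) - (c₀ + c₁ * U) - k) -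
          (βh₁ * (a * F) + βh₂ * (b * (((U₂ - U) * L₁ + (U - U₁) * L₂) / (U₂ - U₁)))) =
        ((U₂ - U) * (β₀ * (a * F + b * L₁ - (c₀ + c₁ * U₁) - k) - (βh₁ * (a * F) + βh₂ * (b * L₁))) +
          (U - U₁) * (β₀ * (a * F + b * L₂ - (c₀ + c₁ * U₂) - k) - (βh₁ * (a * F) + βh₂ * (b * L₂)))) /
          (U₂ - U₁) := by
      field_simp
      ring
    rw [← hid] at hchord
    linarith

/-! ## §1 `T = 0`: field ground states on a cell -/

/-- **FIELD PS EXCLUSION ON A CELL, `T = 0`, COLUMN FORM.** Cell `[s₁, s₂] × [U₁, U₂]` (`0 ≤ U₁ < U₂`); densities `0 ≤ n₁ < n₂ ≤ 1`,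
weights `a, b ≥ 0`, `a + b = 1`; zero-field DATA as in `ps_not_groundState_mix_on_cell_of_columns` (cap `c₀ + c₁U` at `an₁ + bn₂`, column laws
`L_i(s) ≤ e(t,s,U_i,n₂)`, dilute floor `F₁(s)`) and POSITIVE COLUMN MARGINS AFTER THE FIELD COST,
`c₀ + c₁U_i + h₀·(an₁ + bn₂) < aF₁(s) + bL_i(s)`. THEN for every `|h| ≤ h₀` and every `(s, U)` of the cell no mixture `λω₁ + (1−λ)ω₂`
(`0 < λ < 1`) of translation-invariant states with `0 < ρ(ω₁) ≤ n₁`, `n₂ ≤ ρ(ω₂) < 2` is a ground state of `Φ(t,s,U) − h·(n↑−n↓)` at its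
filling. [cite: Israel1979, Thm. I.2.4] [cite: Griffiths1964, Appendix] [cite: EmeryKivelsonLin1990, pp. 475–476] -/
theorem psH_not_fieldGroundState_mix_on_cell_of_columns (t : ℝ) {s₁ s₂ U₁ U₂ n₁ n₂ a b c₀ c₁ h₀ hz : ℝ} (hU₁ : 0 ≤ U₁)
    (h12 : U₁ < U₂) (hn₁ : 0 ≤ n₁) (hn : n₁ < n₂) (hn₂ : n₂ ≤ 1) (ha : 0 ≤ a) (hb : 0 ≤ b) (hab : a + b = 1)
    {L₁ L₂ F₁ : ℝ → ℝ}
    (hC : ∀ s ∈ Icc s₁ s₂, ∀ U ∈ Icc U₁ U₂, energyDensityTT' t s U (a * n₁ + b * n₂) ≤ c₀ + c₁ * U)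
    (hL₁ : ∀ s ∈ Icc s₁ s₂, L₁ s ≤ energyDensityTT' t s U₁ n₂) (hL₂ : ∀ s ∈ Icc s₁ s₂, L₂ s ≤ energyDensityTT' t s U₂ n₂)
    (hF₁ : ∀ s ∈ Icc s₁ s₂, ∀ U ∈ Icc U₁ U₂, F₁ s ≤ energyDensityTT' t s U n₁)
    (hh : |hz| ≤ h₀)
    (hm₁ : ∀ s ∈ Icc s₁ s₂, c₀ + c₁ * U₁ + h₀ * (a * n₁ + b * n₂) < a * F₁ s + b * L₁ s)
    (hm₂ : ∀ s ∈ Icc s₁ s₂, c₀ + c₁ * U₂ + h₀ * (a * n₁ + b * n₂) < a * F₁ s + b * L₂ s)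
    {s : ℝ} (hs : s ∈ Icc s₁ s₂) {U : ℝ} (hU : U ∈ Icc U₁ U₂)
    {ω₁ ω₂ : InfVolFermionState 2} (h₁ : ω₁.IsTranslationInvariant) (h₂ : ω₂.IsTranslationInvariant)
    (hρ₁ : 0 < ω₁.density) (hρ₁' : ω₁.density ≤ n₁) (hρ₂ : n₂ ≤ ω₂.density) (hρ₂' : ω₂.density < 2)
    {lam : ℝ} (hl0 : 0 < lam) (hl1 : lam < 1) :
    (gcInteractionTT' t s U 0 hz).tiGroundEnergyDensityAt 1 (mix lam hl0.le hl1.le ω₁ ω₂).density <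
      (mix lam hl0.le hl1.le ω₁ ω₂).meanEnergy (gcInteractionTT' t s U 0 hz) 1 := by
  have hn2' : 0 ≤ n₂ := hn₁.trans hn.le
  have hn₂2 : n₂ < 2 := by linarith
  have hF₂ := floor_on_cell_of_columnLaws t hn2' hn₂2 hU₁ h12 hL₁ hL₂ s hs U hU
  refine h₁.fieldGroundEnergy_lt_meanEnergy_mix_of_cap_lt_floors_of_abs_le t s (hU₁.trans hU.1) hz h₂ hρ₁ hρ₂' hρ₁' hn hρ₂
    hn₂ ha hb hab (hC s hs U hU) (hF₁ s hs U hU) hF₂ hh ?_ hl0 hl1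
  have hpos := uchord_pos_of_ends h12 hU (sub_pos.2 (hm₁ s hs)) (sub_pos.2 (hm₂ s hs))
  have hd : (U₂ - U₁) ≠ 0 := (sub_pos.2 h12).ne'
  have hid : a * F₁ s + b * (((U₂ - U) * L₁ s + (U - U₁) * L₂ s) / (U₂ - U₁)) - (c₀ + c₁ * U + h₀ * (a * n₁ + b * n₂)) =
      ((U₂ - U) * (a * F₁ s + b * L₁ s - (c₀ + c₁ * U₁ + h₀ * (a * n₁ + b * n₂))) +
        (U - U₁) * (a * F₁ s + b * L₂ s - (c₀ + c₁ * U₂ + h₀ * (a * n₁ + b * n₂)))) / (U₂ - U₁) := by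
    field_simp
    ring
  have h := hid ▸ hpos
  linarith

/-- **FIELD PS EXCLUSION ABOVE A COLUMN, `T = 0`.** For `U ∈ [U₂, U₃]` (`U₂ ≥ 0`): cap `c₀ + c₁U` with `c₁ ≥ 0`, ONE column law
`L(s) ≤ e(t,s,U₂,n₂)`, a dilute floor `F₁(s)` on the cell, and the FAR-END margin after the field cost,
`c₀ + c₁U₃ + h₀·(an₁ + bn₂) < aF₁(s) + bL(s)`: the mixtures are excluded among field ground states on the whole cell, every `|h| ≤ h₀`.
[cite: Israel1979, Thm. I.2.4] [cite: Griffiths1964, Appendix] -/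
theorem psH_not_fieldGroundState_mix_above_column (t : ℝ) {s₁ s₂ U₂ U₃ n₁ n₂ a b c₀ c₁ h₀ hz : ℝ} (hU₂ : 0 ≤ U₂)
    (hc₁ : 0 ≤ c₁) (hn₁ : 0 ≤ n₁) (hn : n₁ < n₂) (hn₂ : n₂ ≤ 1) (ha : 0 ≤ a) (hb : 0 ≤ b) (hab : a + b = 1)
    {L F₁ : ℝ → ℝ}
    (hC : ∀ s ∈ Icc s₁ s₂, ∀ U ∈ Icc U₂ U₃, energyDensityTT' t s U (a * n₁ + b * n₂) ≤ c₀ + c₁ * U)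
    (hL : ∀ s ∈ Icc s₁ s₂, L s ≤ energyDensityTT' t s U₂ n₂)
    (hF₁ : ∀ s ∈ Icc s₁ s₂, ∀ U ∈ Icc U₂ U₃, F₁ s ≤ energyDensityTT' t s U n₁)
    (hh : |hz| ≤ h₀)
    (hm : ∀ s ∈ Icc s₁ s₂, c₀ + c₁ * U₃ + h₀ * (a * n₁ + b * n₂) < a * F₁ s + b * L s)
    {s : ℝ} (hs : s ∈ Icc s₁ s₂) {U : ℝ} (hU : U ∈ Icc U₂ U₃)
    {ω₁ ω₂ : InfVolFermionState 2} (h₁ : ω₁.IsTranslationInvariant) (h₂ : ω₂.IsTranslationInvariant)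
    (hρ₁ : 0 < ω₁.density) (hρ₁' : ω₁.density ≤ n₁) (hρ₂ : n₂ ≤ ω₂.density) (hρ₂' : ω₂.density < 2)
    {lam : ℝ} (hl0 : 0 < lam) (hl1 : lam < 1) :
    (gcInteractionTT' t s U 0 hz).tiGroundEnergyDensityAt 1 (mix lam hl0.le hl1.le ω₁ ω₂).density <
      (mix lam hl0.le hl1.le ω₁ ω₂).meanEnergy (gcInteractionTT' t s U 0 hz) 1 := by
  have hn2' : 0 ≤ n₂ := hn₁.trans hn.le
  have hn₂2 : n₂ < 2 := by linarith
  have hF₂ := floor_above_column_of_law t hn2' hn₂2 hU₂ hL s hs U hU.1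
  refine h₁.fieldGroundEnergy_lt_meanEnergy_mix_of_cap_lt_floors_of_abs_le t s (hU₂.trans hU.1) hz h₂ hρ₁ hρ₂' hρ₁' hn hρ₂
    hn₂ ha hb hab (hC s hs U hU) (hF₁ s hs U hU) hF₂ hh ?_ hl0 hl1
  have k := mul_le_mul_of_nonneg_left hU.2 hc₁
  have := hm s hs
  linarith

/-! ## §2 `T > 0`: canonical field equilibrium states on a cell, hot-anchored column × threshold forms -/

/-- **FIELD THERMAL PS EXCLUSION ON A CELL, COLUMN × THRESHOLD FORM.** Cell `[s₁, s₂] × [U₁, U₂]` (`0 ≤ U₁ < U₂`), `0 ≤ n₁ < n₂ ≤ 1`,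
weights `a + b = 1`; zero-field data as in `psT_not_thermal_mix_on_cell_of_columns_hotAnchor` (cap `c₀ + c₁U`, column laws `L₁, L₂`,
dilute floor `F₁`, cell-uniform anchors `p(β_{h,i}; n_i) ≤ π_i`, `0 ≤ β_{h,i} ≤ β₀ ≤ β`) and, on BOTH columns, the `T = 0` margin AFTER
the field cost `k = h₀·(an₁ + bn₂)` is `≥ 0` and the ANCHORED INEQUALITY holds at `β₀` with that margin:
`aπ₁ + bπ₂ + β_{h,1}aF₁(s) + β_{h,2}bL_i(s) < β₀·(aF₁(s) + bL_i(s) − (c₀ + c₁U_i) − k)`. THEN for every `|h| ≤ h₀` and every `(s, U)` of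
the cell, no mixture `λω₁ + (1−λ)ω₂` (`0 < λ < 1`) of translation-invariant states with `0 < ρ(ω₁) ≤ n₁`, `n₂ ≤ ρ(ω₂) < 2` is a canonical
equilibrium state of `Φ(t,s,U) − h·(n↑−n↓)` at `β`: `s̄(mix) − β(e_Φ(mix) − h m(mix)) < p_h(β; t,s,U; ρ(mix))`.
[cite: Israel1979, Thm. I.2.4] [cite: PoulinHastings2011, eqs. (3)–(8)] [cite: LiebPRL1989, proof of Theorem 1] -/
theorem psHT_not_fieldEquilibrium_mix_on_cell_of_columns_hotAnchor (t : ℝ)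
    {s₁ s₂ U₁ U₂ n₁ n₂ a b c₀ c₁ β β₀ βh₁ βh₂ π₁ π₂ h₀ hz : ℝ}
    (hU₁ : 0 ≤ U₁) (h12 : U₁ < U₂) (hn₁ : 0 ≤ n₁) (hn : n₁ < n₂) (hn₂ : n₂ ≤ 1) (ha : 0 ≤ a) (hb : 0 ≤ b)
    (hab : a + b = 1) (hβh₁ : 0 ≤ βh₁) (hβh₂ : 0 ≤ βh₂) (h0₁ : βh₁ ≤ β₀) (h0₂ : βh₂ ≤ β₀) (hβ₀ : β₀ ≤ β)
    (hβ₀pos : 0 < β₀) {L₁ L₂ F₁ : ℝ → ℝ}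
    (hC : ∀ s ∈ Icc s₁ s₂, ∀ U ∈ Icc U₁ U₂, energyDensityTT' t s U (a * n₁ + b * n₂) ≤ c₀ + c₁ * U)
    (hL₁ : ∀ s ∈ Icc s₁ s₂, L₁ s ≤ energyDensityTT' t s U₁ n₂) (hL₂ : ∀ s ∈ Icc s₁ s₂, L₂ s ≤ energyDensityTT' t s U₂ n₂)
    (hF₁ : ∀ s ∈ Icc s₁ s₂, ∀ U ∈ Icc U₁ U₂, F₁ s ≤ energyDensityTT' t s U n₁)
    (hπ₁ : ∀ s ∈ Icc s₁ s₂, ∀ U ∈ Icc U₁ U₂, pressureTT' βh₁ t s U n₁ ≤ π₁)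
    (hπ₂ : ∀ s ∈ Icc s₁ s₂, ∀ U ∈ Icc U₁ U₂, pressureTT' βh₂ t s U n₂ ≤ π₂)
    (hh : |hz| ≤ h₀)
    (hm₁ : ∀ s ∈ Icc s₁ s₂, 0 ≤ a * F₁ s + b * L₁ s - (c₀ + c₁ * U₁) - h₀ * (a * n₁ + b * n₂))
    (hm₂ : ∀ s ∈ Icc s₁ s₂, 0 ≤ a * F₁ s + b * L₂ s - (c₀ + c₁ * U₂) - h₀ * (a * n₁ + b * n₂))
    (hg₁ : ∀ s ∈ Icc s₁ s₂, a * π₁ + b * π₂ + βh₁ * (a * F₁ s) + βh₂ * (b * L₁ s) <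
      β₀ * (a * F₁ s + b * L₁ s - (c₀ + c₁ * U₁) - h₀ * (a * n₁ + b * n₂)))
    (hg₂ : ∀ s ∈ Icc s₁ s₂, a * π₁ + b * π₂ + βh₁ * (a * F₁ s) + βh₂ * (b * L₂ s) <
      β₀ * (a * F₁ s + b * L₂ s - (c₀ + c₁ * U₂) - h₀ * (a * n₁ + b * n₂)))
    {s : ℝ} (hs : s ∈ Icc s₁ s₂) {U : ℝ} (hU : U ∈ Icc U₁ U₂)
    {ω₁ ω₂ : InfVolFermionState 2} (h₁ : ω₁.IsTranslationInvariant) (h₂ : ω₂.IsTranslationInvariant)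
    (hρ₁ : 0 < ω₁.density) (hρ₁' : ω₁.density ≤ n₁) (hρ₂ : n₂ ≤ ω₂.density) (hρ₂' : ω₂.density < 2)
    {lam : ℝ} (hl0 : 0 < lam) (hl1 : lam < 1) :
    (mix lam hl0.le hl1.le ω₁ ω₂).entropyDensitySup -
        β * (mix lam hl0.le hl1.le ω₁ ω₂).meanEnergy (gcInteractionTT' t s U 0 hz) 1 <
      pressureTT'Zeeman β t s U (mix lam hl0.le hl1.le ω₁ ω₂).density hz := by
  have hn2' : 0 ≤ n₂ := hn₁.trans hn.le
  have hn₂2 : n₂ < 2 := by linarith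
  have hβpos : 0 < β := hβ₀pos.trans_le hβ₀
  have hF₂ := floor_on_cell_of_columnLaws t hn2' hn₂2 hU₁ h12 hL₁ hL₂ s hs U hU
  obtain ⟨hMnn, hM₀⟩ := hotAnchor_chord_slack (βh₁ := βh₁) (βh₂ := βh₂) (π₁ := π₁) (π₂ := π₂) h12 hU (hm₁ s hs) (hm₂ s hs)
    (hg₁ s hs) (hg₂ s hs)
  exact h₁.sub_mul_field_lt_pressureTT'Zeeman_mix_of_hotAnchors_of_threshold_of_abs_le t s (hU₁.trans hU.1) hβpos hz h₂ hρ₁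
    hρ₂' hρ₁' hn hρ₂ hn₂ ha hb hab (hC s hs U hU) (hF₁ s hs U hU) hF₂ hβh₁ hβh₂ h0₁ h0₂ hβ₀ (hπ₁ s hs U hU) (hπ₂ s hs U hU)
    hh hMnn hM₀ hl0 hl1

/-- **FIELD THERMAL PS EXCLUSION ABOVE A COLUMN (threshold form).** For `U ∈ [U₂, U₃]` (`U₂ ≥ 0`): cap `c₀ + c₁U` with `c₁ ≥ 0`, ONE
column law `L(s) ≤ e(t,s,U₂,n₂)`, dilute floor `F₁(s)`, cell-uniform anchors (`0 ≤ β_{h,i} ≤ β₀ ≤ β`), and at the FAR END `U₃` the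
`T = 0` margin after the field cost `k = h₀·(an₁ + bn₂)` is `≥ 0` and the anchored inequality holds at `β₀`: the exclusion among canonical
field equilibrium states holds on the whole cell at `β`, every `|h| ≤ h₀`. [cite: Israel1979, Thm. I.2.4]
[cite: Griffiths1964, Appendix] [cite: PoulinHastings2011, eqs. (3)–(8)] -/
theorem psHT_not_fieldEquilibrium_mix_above_column_hotAnchor (t : ℝ)
    {s₁ s₂ U₂ U₃ n₁ n₂ a b c₀ c₁ β β₀ βh₁ βh₂ π₁ π₂ h₀ hz : ℝ}
    (hU₂ : 0 ≤ U₂) (hc₁ : 0 ≤ c₁) (hn₁ : 0 ≤ n₁) (hn : n₁ < n₂) (hn₂ : n₂ ≤ 1) (ha : 0 ≤ a) (hb : 0 ≤ b)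
    (hab : a + b = 1) (hβh₁ : 0 ≤ βh₁) (hβh₂ : 0 ≤ βh₂) (h0₁ : βh₁ ≤ β₀) (h0₂ : βh₂ ≤ β₀) (hβ₀ : β₀ ≤ β) (hβ₀pos : 0 < β₀)
    {L F₁ : ℝ → ℝ}
    (hC : ∀ s ∈ Icc s₁ s₂, ∀ U ∈ Icc U₂ U₃, energyDensityTT' t s U (a * n₁ + b * n₂) ≤ c₀ + c₁ * U)
    (hL : ∀ s ∈ Icc s₁ s₂, L s ≤ energyDensityTT' t s U₂ n₂)
    (hF₁ : ∀ s ∈ Icc s₁ s₂, ∀ U ∈ Icc U₂ U₃, F₁ s ≤ energyDensityTT' t s U n₁)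
    (hπ₁ : ∀ s ∈ Icc s₁ s₂, ∀ U ∈ Icc U₂ U₃, pressureTT' βh₁ t s U n₁ ≤ π₁)
    (hπ₂ : ∀ s ∈ Icc s₁ s₂, ∀ U ∈ Icc U₂ U₃, pressureTT' βh₂ t s U n₂ ≤ π₂)
    (hh : |hz| ≤ h₀)
    (hm : ∀ s ∈ Icc s₁ s₂, 0 ≤ a * F₁ s + b * L s - (c₀ + c₁ * U₃) - h₀ * (a * n₁ + b * n₂))
    (hg : ∀ s ∈ Icc s₁ s₂, a * π₁ + b * π₂ + βh₁ * (a * F₁ s) + βh₂ * (b * L s) <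
      β₀ * (a * F₁ s + b * L s - (c₀ + c₁ * U₃) - h₀ * (a * n₁ + b * n₂)))
    {s : ℝ} (hs : s ∈ Icc s₁ s₂) {U : ℝ} (hU : U ∈ Icc U₂ U₃)
    {ω₁ ω₂ : InfVolFermionState 2} (h₁ : ω₁.IsTranslationInvariant) (h₂ : ω₂.IsTranslationInvariant)
    (hρ₁ : 0 < ω₁.density) (hρ₁' : ω₁.density ≤ n₁) (hρ₂ : n₂ ≤ ω₂.density) (hρ₂' : ω₂.density < 2)
    {lam : ℝ} (hl0 : 0 < lam) (hl1 : lam < 1) :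
    (mix lam hl0.le hl1.le ω₁ ω₂).entropyDensitySup -
        β * (mix lam hl0.le hl1.le ω₁ ω₂).meanEnergy (gcInteractionTT' t s U 0 hz) 1 <
      pressureTT'Zeeman β t s U (mix lam hl0.le hl1.le ω₁ ω₂).density hz := by
  have hn2' : 0 ≤ n₂ := hn₁.trans hn.le
  have hn₂2 : n₂ < 2 := by linarith
  have hβpos : 0 < β := hβ₀pos.trans_le hβ₀
  have hF₂ := floor_above_column_of_law t hn2' hn₂2 hU₂ hL s hs U hU.1
  -- the margin at `U ≤ U₃` dominates the far-end margin (`c₁ ≥ 0`), and so does the anchored slack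
  have k := mul_le_mul_of_nonneg_left hU.2 hc₁
  have hM3 := hm s hs
  have hM : a * F₁ s + b * L s - (c₀ + c₁ * U₃) - h₀ * (a * n₁ + b * n₂) ≤
      a * F₁ s + b * L s - (c₀ + c₁ * U) - h₀ * (a * n₁ + b * n₂) := by linarith
  have hMU : 0 ≤ a * F₁ s + b * L s - (c₀ + c₁ * U) - h₀ * (a * n₁ + b * n₂) := hM3.trans hM
  have k1 := mul_le_mul_of_nonneg_left hM hβ₀pos.le
  have hg' := hg s hs
  have hM₀ : a * π₁ + b * π₂ + βh₁ * (a * F₁ s) + βh₂ * (b * L s) <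
      β₀ * (a * F₁ s + b * L s - (c₀ + c₁ * U) - h₀ * (a * n₁ + b * n₂)) := by linarith
  exact h₁.sub_mul_field_lt_pressureTT'Zeeman_mix_of_hotAnchors_of_threshold_of_abs_le t s (hU₂.trans hU.1) hβpos hz h₂ hρ₁
    hρ₂' hρ₁' hn hρ₂ hn₂ ha hb hab (hC s hs U hU) (hF₁ s hs U hU) hF₂ hβh₁ hβh₂ h0₁ h0₂ hβ₀ (hπ₁ s hs U hU) (hπ₂ s hs U hU)
    hh hMU hM₀ hl0 hl1


/-! ## §4 `s`-DEPENDENT `n₂`-anchor `Q₂(s)` in a field (g24 append): the above-column form for `t′`-CHORDED anchors -/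

/-- **`T > 0` FIELD EXCLUSION ABOVE A COLUMN with an `s`-DEPENDENT `n₂`-ANCHOR `Q₂(s)`**: as
`psHT_not_fieldEquilibrium_mix_above_column_hotAnchor` with `b·π₂` replaced by `b·Q₂(s)` (e.g. the `t′`-chord of two equal-`β_h` anchors,
`pressureTT'_le_schord_of_anchors`; for `Q₂` affine in `s` both conditions are checked at the `s`-ends).
[cite: Israel1979, Thm. I.2.4] [cite: Griffiths1966, §II] [cite: PoulinHastings2011, eqs. (3)–(8)] -/
theorem psHT_not_fieldEquilibrium_mix_above_column_hotAnchorS (t : ℝ)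
    {s₁ s₂ U₂ U₃ n₁ n₂ a b c₀ c₁ β β₀ βh₁ βh₂ π₁ h₀ hz : ℝ}
    (hU₂ : 0 ≤ U₂) (hc₁ : 0 ≤ c₁) (hn₁ : 0 ≤ n₁) (hn : n₁ < n₂) (hn₂ : n₂ ≤ 1) (ha : 0 ≤ a) (hb : 0 ≤ b)
    (hab : a + b = 1) (hβh₁ : 0 ≤ βh₁) (hβh₂ : 0 ≤ βh₂) (h0₁ : βh₁ ≤ β₀) (h0₂ : βh₂ ≤ β₀) (hβ₀ : β₀ ≤ β) (hβ₀pos : 0 < β₀)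
    {L F₁ Q₂ : ℝ → ℝ}
    (hC : ∀ s ∈ Icc s₁ s₂, ∀ U ∈ Icc U₂ U₃, energyDensityTT' t s U (a * n₁ + b * n₂) ≤ c₀ + c₁ * U)
    (hL : ∀ s ∈ Icc s₁ s₂, L s ≤ energyDensityTT' t s U₂ n₂)
    (hF₁ : ∀ s ∈ Icc s₁ s₂, ∀ U ∈ Icc U₂ U₃, F₁ s ≤ energyDensityTT' t s U n₁)
    (hπ₁ : ∀ s ∈ Icc s₁ s₂, ∀ U ∈ Icc U₂ U₃, pressureTT' βh₁ t s U n₁ ≤ π₁)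
    (hπ₂ : ∀ s ∈ Icc s₁ s₂, ∀ U ∈ Icc U₂ U₃, pressureTT' βh₂ t s U n₂ ≤ Q₂ s)
    (hh : |hz| ≤ h₀)
    (hm : ∀ s ∈ Icc s₁ s₂, 0 ≤ a * F₁ s + b * L s - (c₀ + c₁ * U₃) - h₀ * (a * n₁ + b * n₂))
    (hg : ∀ s ∈ Icc s₁ s₂, a * π₁ + b * Q₂ s + βh₁ * (a * F₁ s) + βh₂ * (b * L s) <
      β₀ * (a * F₁ s + b * L s - (c₀ + c₁ * U₃) - h₀ * (a * n₁ + b * n₂)))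
    {s : ℝ} (hs : s ∈ Icc s₁ s₂) {U : ℝ} (hU : U ∈ Icc U₂ U₃)
    {ω₁ ω₂ : InfVolFermionState 2} (h₁ : ω₁.IsTranslationInvariant) (h₂ : ω₂.IsTranslationInvariant)
    (hρ₁ : 0 < ω₁.density) (hρ₁' : ω₁.density ≤ n₁) (hρ₂ : n₂ ≤ ω₂.density) (hρ₂' : ω₂.density < 2)
    {lam : ℝ} (hl0 : 0 < lam) (hl1 : lam < 1) :
    (mix lam hl0.le hl1.le ω₁ ω₂).entropyDensitySup -
        β * (mix lam hl0.le hl1.le ω₁ ω₂).meanEnergy (gcInteractionTT' t s U 0 hz) 1 <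
      pressureTT'Zeeman β t s U (mix lam hl0.le hl1.le ω₁ ω₂).density hz := by
  have hn2' : 0 ≤ n₂ := hn₁.trans hn.le
  have hn₂2 : n₂ < 2 := by linarith
  have hβpos : 0 < β := hβ₀pos.trans_le hβ₀
  have hF₂ := floor_above_column_of_law t hn2' hn₂2 hU₂ hL s hs U hU.1
  have k := mul_le_mul_of_nonneg_left hU.2 hc₁
  have hM3 := hm s hs
  have hM : a * F₁ s + b * L s - (c₀ + c₁ * U₃) - h₀ * (a * n₁ + b * n₂) ≤
      a * F₁ s + b * L s - (c₀ + c₁ * U) - h₀ * (a * n₁ + b * n₂) := by linarith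
  have hMU : 0 ≤ a * F₁ s + b * L s - (c₀ + c₁ * U) - h₀ * (a * n₁ + b * n₂) := hM3.trans hM
  have k1 := mul_le_mul_of_nonneg_left hM hβ₀pos.le
  have hg' := hg s hs
  have hM₀ : a * π₁ + b * Q₂ s + βh₁ * (a * F₁ s) + βh₂ * (b * L s) <
      β₀ * (a * F₁ s + b * L s - (c₀ + c₁ * U) - h₀ * (a * n₁ + b * n₂)) := by linarith
  exact h₁.sub_mul_field_lt_pressureTT'Zeeman_mix_of_hotAnchors_of_threshold_of_abs_le t s (hU₂.trans hU.1) hβpos hz h₂ hρ₁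
    hρ₂' hρ₁' hn hρ₂ hn₂ ha hb hab (hC s hs U hU) (hF₁ s hs U hU) hF₂ hβh₁ hβh₂ h0₁ h0₂ hβ₀ (hπ₁ s hs U hU) (hπ₂ s hs U hU)
    hh hMU hM₀ hl0 hl1

end Summit.Ventures.CertifiedManyBodySolver.Observables
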